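import Summits.BirchSwinnertonDyer.BirchSwinnertonDyer.Theorems.EdixhovenFibreFiveSevenStarredOptimalManinUnitFiveSevenTransportedReciprocitySocket
import Literature.NumberTheory.PAdicHodge.CMFibreCellsGoodSupersingularData
import Literature.NumberTheory.PAdicHodge.KummerFilZeroCoboundaryRationalPointsCells
import Literature.NumberTheory.PAdicHodge.WeilTowerAlternating
import Literature.NumberTheory.PAdicHodge.WeilTowerNondegenerate
import Literature.NumberTheory.PAdicHodge.LogCyclotomicCupProductNorm
import HarnessLib

/-!
# Kato's explicit reciprocity law in the v10 socket's shape with the SIX ellipticity / integrality INSTANCE binders of the model and of the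
# CM fibre DISCHARGED from `IsUnit Δ(W♭)` and `p ∤ Δ(E₀)` (sequel of `…TransportedReciprocitySocket`)

Cell `pub/bsd-wall`, D-0145 line `route-BirchSwinnertonDyer-EdixhovenFibreFiveSeven`, seat `bsd-line-edix-p4` (gen 28); crux K★
`stmt-BirchSwinnertonDyer-22226` (`StarredOptimalManinUnitFiveSeven`), line `kato_lever`, memos `Cruxes/StarredOptimalManinUnitFiveSeven/Lines/
kato-lever-K2-transport-allpoints.md` §2 and `…/kato-lever-seam-rec-at-cells.md` §13 (the socket `stub_localFormulaSupersingularCells`, with `halt` in v10).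
THEOREMS ONLY (no definition, no named fact, no instance, no `sorry`); helper `--supports stmt-BirchSwinnertonDyer-22226`. **BSD is not proved by this file,
and neither is K★ or [REC-tower].** It is `…TransportedReciprocityOfVariableChange.exists_const_tatePairingPoint_eq_trace_mul_padicLog_of_variableChange` (E6)
with three groups of inputs DISCHARGED so that the remaining ones are socket binders or per-cell model data: the `ℤ_p`-homogeneity / alternation /
non-degeneracy of `e_∞` on `T_pW` (`heL`, `healt`, `henondeg`) from the LEVELWISE laws `halt`, `hnondeg` of the Weil tower
(`PAdicHodge.WeilTowerAlternating` / `WeilTowerNondegenerate`), the continuous additive `ψ : Γ_F → ℤ_p` with `ψ = log χ_cyclo`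
(`exists_continuousMap_coe_eq_logCyclotomic`), and `p ≠ 2` from `p ≥ 5`.

* ★★★★ `exists_const_tatePairingPoint_eq_trace_mul_padicLog_socket_light` — as `…_socket` of `…TransportedReciprocitySocket`, minus the instance binders
  `[(curveFO F W♭).IsElliptic] [(curveOver ℂ_F W♭).IsElliptic] [(curveFO F W♭).IsIntegral w.integer] [(E₀ ⊗ ℚ_p).IsElliptic] [(E₀ ⊗ 𝔽_p).IsElliptic]
  [(curveOver ℂ_F E₀).IsElliptic]` (`AinfTop.isElliptic_curveFO`, `isElliptic_curveOverC_O`, `isIntegral_curveFO`, `CMFibreCellsGoodSupersingularData`): for `W/K₀ ⊆ F = K_v` elliptic with a Weil tower satisfying the SEVEN levelwise laws,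
  the de Rham binders `hinj/hde` of `T_pW|_{Γ_F}` and a line `d`, the model data (`Dv`, `W_D`, `ψm`, `Δ` unit, Hasse `0`, `E₀`, `hWE`, `N ≥ e`, (N1′)), a
  compatible `w` and ONE change of variables `C` with `C • (W ⊗ F) = E`, `|u|_w ≤ 1`:
  **`∃ c, ∀ η ∈ Z¹(Γ_F, T_pW), ∀ P ∈ W(F): ⟨[η], P⟩_W = Tr_{F/ℚ_p}(c · exp*_d(η) · log_ω^{W ⊗ F}(P))`.**

References: [cite: Kato1993LNM1553, Ch. II §1.2.2, Thm. 1.4.1 (3)–(4), Lemma 1.4.3] · [cite: SilvermanAEC2009, Prop. III.8.1, III.1 Table 3.1, X §4].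
-/

set_option autoImplicit false
-- single-conjunct summit: `Summit.BirchSwinnertonDyer.BirchSwinnertonDyer.…` repeats the name by design
set_option linter.dupNamespace false

noncomputable section

open Field Function ValuativeRel WittVector NumberField IsDedekindDomain
open scoped NumberField Topology Classical NNReal
open Literature.NumberTheory.PAdicHodge Literature.NumberTheory.GaloisRepresentations
  Literature.NumberTheory.GaloisRepresentations.IsNonarchimedeanLocalField Literature.NumberTheory.GaloisRepresentations.LubinTate
  Literature.NumberTheory.GaloisCohomology Literature.NumberTheory.EllipticCurves Literature.NumberTheory.EllipticCurves.FormalGroupChart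
  Literature.NumberTheory.PAdicHodge.GaloisContinuity Literature.IUT.LogVolume Literature.RingTheory.FormalGroups
  Literature.AlgebraicGeometry.Resolution _root_.WeierstrassCurve _root_.WeierstrassCurve.VariableChange

namespace Summit.BirchSwinnertonDyer.BirchSwinnertonDyer.Theorems.TransportedReciprocitySocketLight

variable {K : Type} [Field K] [NumberField K] {p : ℕ} [hprime : Fact p.Prime] (v : HeightOneSpectrum (𝓞 K))
  [CharZero (v.adicCompletion K)] [LocallyCompactSpace (absoluteGaloisGroup (v.adicCompletion K))]
  [Fact (¬ IsUnit (p : integerC (v.adicCompletion K)))]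
  [IsAdicComplete (Ideal.span {(p : integerC (v.adicCompletion K))}) (integerC (v.adicCompletion K))]
  [CharP 𝓀[v.adicCompletion K] p] [CharZero (CompletedAlgClosure (v.adicCompletion K))]
  (hpv : valuation (v.adicCompletion K) (p : v.adicCompletion K) < 1)
  (Dv : EisensteinRoot (v.adicCompletion K) p hpv) (Wm : WeierstrassCurve (EisensteinRoot.CoeffDisc Dv))
  (ψm : EisensteinRoot.CoeffDisc Dv →+* LTCoeff (v.adicCompletion K))
  (hψm : ∀ c, algebraMap (LTCoeff (v.adicCompletion K)) (v.adicCompletion K) (ψm c) = EisensteinRoot.CoeffDisc.toF Dv c)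
  (hΔ : IsUnit (Wm.map ψm).Δ) (hA : ((Wm.map ψm).map (AinfTop.redCoeff (v.adicCompletion K))).hasseCoeff p = 0)
  -- the curve `W/K₀` and its Weil tower
  {K₀ : Type} [Field K₀] [CharZero K₀] (W : WeierstrassCurve K₀) [W.IsElliptic] [Algebra K₀ (v.adicCompletion K)]
  (e : (k : ℕ) → geomTorsion W ((p ^ k : ℕ) : ℤ) → geomTorsion W ((p ^ k : ℕ) : ℤ) → AlgebraicClosure K₀)
  (hμ : ∀ k S T, e k S T ^ (p ^ k) = 1) (hadd₁ : ∀ k S₁ S₂ T, e k (S₁ + S₂) T = e k S₁ T * e k S₂ T)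
  (hadd₂ : ∀ k S T₁ T₂, e k S (T₁ + T₂) = e k S T₁ * e k S T₂)
  (hgal : ∀ k (σ : absoluteGaloisGroup K₀) (S T : geomTorsion W ((p ^ k : ℕ) : ℤ)), σ • e k S T = e k (σ • S) (σ • T))
  (hcompat : ∀ k (S T : geomTorsion W ((p ^ (k + 1) : ℕ) : ℤ)),
    e k (torsionMulHom W (p ^ (k + 1)) (p ^ k) p (pow_succ p k).symm S)
      (torsionMulHom W (p ^ (k + 1)) (p ^ k) p (pow_succ p k).symm T) = e (k + 1) S T ^ p)

set_option maxHeartbeats 1600000 in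
include hgal hΔ hA hψm in
/-- ★★★★ **Kato's explicit reciprocity law in the v10 socket's shape, instance-light.** As
`TransportedReciprocitySocket.exists_const_tatePairingPoint_eq_trace_mul_padicLog_socket` (the six ellipticity / integrality instances of the model
and of `E₀` are derived inside from `hΔ`, `hΔ₀`); i.e. as `…_of_variableChange`, but the Weil tower of `W` is given with its
LEVELWISE laws only (`hμ hadd₁ hadd₂ hgal hcompat` + alternation `halt` + non-degeneracy `hnondeg`; the limit laws `heL/healt/henondeg` are derived), the
character `ψ = log χ_cyclo : Γ_F → ℤ_p` is constructed inside, and `p ≠ 2` is read off `p ≥ 5`. Conclusion: ONE `c ∈ F` with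
**`⟨[η], P⟩_W = Tr_{F/ℚ_p}(c · exp*_d(η) · log_ω(P))`** for every cocycle `η` of `T_pW|_{Γ_F}` and EVERY `P ∈ W(F)`, `log_ω = padicLogPointFiniteExt w (W ⊗ F) p`.
[cite: Kato1993LNM1553, Ch. II §1.2.2 and Thm. 1.4.1 (3)–(4)] [cite: SilvermanAEC2009, Prop. III.8.1, III.1 Table 3.1] -/
theorem exists_const_tatePairingPoint_eq_trace_mul_padicLog_socket_light (hp5 : 5 ≤ p)
    (E₀ : WeierstrassCurve ℤ)
    (hWE : Wm.map (Ideal.Quotient.mk (Ideal.span {EisensteinRoot.CoeffDisc.of Dv (AdjoinRoot.root Dv.poly)})) =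
      (E₀.map (algebraMap ℤ (EisensteinRoot.CoeffDisc Dv))).map
        (Ideal.Quotient.mk (Ideal.span {EisensteinRoot.CoeffDisc.of Dv (AdjoinRoot.root Dv.poly)})))
    (hΔ₀ : ¬ (p : ℤ) ∣ E₀.Δ) (hA₀ : (E₀.map (Int.castRingHom (ZMod p))).hasseCoeff p = 0)
    {N : ℕ} (hN : Dv.e ≤ N)
    (hN1' : ∃ τ : AinfTop.TatePtO (v.adicCompletion K) (Wm.map ψm) p,
      AinfRamTop.omegaPeriod Wm (surjective_fontaineTheta_integerC hpv) (AinfTop.seqO (Wm.map ψm) τ) (AinfTop.seqO_zero (Wm.map ψm) τ)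
        (AinfRamTop.mulPC_seqO Wm ψm hψm τ) ≠ 0)
    -- the LEVELWISE alternation and non-degeneracy of the Weil tower (socket binders)
    (halt : ∀ k (S : geomTorsion W ((p ^ k : ℕ) : ℤ)), e k S S = 1)
    (hnondeg : ∀ k (T : geomTorsion W ((p ^ k : ℕ) : ℤ)), (∀ S, e k S T = 1) → T = 0)
    (hinj : letI := LocalField.padicAlgebra (v.adicCompletion K) p hpv
      (bdRPeriodRingData (F := (v.adicCompletion K)) (p := p) hpv).CupLogInjective (logCyclotomic p)
        (restrictedRationalTateRep W (v.adicCompletion K) p))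
    (hde : letI := LocalField.padicAlgebra (v.adicCompletion K) p hpv
      ∀ η : contOneCocycles (restrictedTateRep W (v.adicCompletion K) p).toTopRep,
        (bdRPeriodRingData (F := (v.adicCompletion K)) (p := p) hpv).HasDualExp (logCyclotomic p)
          (restrictedRationalTateRep W (v.adicCompletion K) p)
          fun σ => TateModule.toRational p (η.1 σ))
    (d : letI := LocalField.padicAlgebra (v.adicCompletion K) p hpv
      (bdRPeriodRingData (F := (v.adicCompletion K)) (p := p) hpv).FilZeroLine
        (restrictedRationalTateRep W (v.adicCompletion K) p))
    -- the change of variables onto the model and the valuation for `log_ω`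
    (w : Valuation (v.adicCompletion K) ℝ≥0) [w.Compatible] [(W.baseChange (v.adicCompletion K)).IsIntegral w.integer]
    (C : VariableChange (v.adicCompletion K)) (hC : C • W.baseChange (v.adicCompletion K) = AinfTop.curveFO (v.adicCompletion K) (Wm.map ψm))
    (hu : w (C.u : v.adicCompletion K) ≤ 1) :
    letI := LocalField.padicAlgebra (v.adicCompletion K) p hpv
    ∃ c : v.adicCompletion K,
      ∀ (η : contOneCocycles (restrictedTateRep W (v.adicCompletion K) p).toTopRep) (P : (W.baseChange (v.adicCompletion K)).toAffine.Point),
        ((tatePairingPoint W (v.adicCompletion K) p e hμ hadd₁ hadd₂ hgal hcompat (oneCocycleClass _ η) P : ℤ_[p]) : ℚ_[p]) =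
          Algebra.trace ℚ_[p] (v.adicCompletion K)
            (c * expStarCoord W hpv d η * padicLogPointFiniteExt w (W.baseChange (v.adicCompletion K)) p P) := by
  letI := LocalField.padicAlgebra (v.adicCompletion K) p hpv
  -- the six instances, from `hΔ` and `hΔ₀`
  haveI := AinfTop.isElliptic_curveFO (Wm.map ψm) hΔ
  haveI := AinfTop.isElliptic_curveOverC_O (F := v.adicCompletion K) (W := Wm.map ψm) hΔ
  haveI := AinfTop.isIntegral_curveFO (Wm.map ψm) w
  have hΔ₀' : E₀.Δ ≠ 0 := fun h => hΔ₀ (h ▸ dvd_zero _)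
  haveI := isElliptic_cmFibre_map_field (K := ℚ_[p]) E₀ hΔ₀'
  haveI := isElliptic_cmFibre_map_zmod (p := p) E₀ hΔ₀
  haveI := isElliptic_curveOver_cmFibre (F := v.adicCompletion K) E₀ hΔ₀'
  -- E7 (STEPWISE application)
  have h1 := TransportedReciprocitySocket.exists_const_tatePairingPoint_eq_trace_mul_padicLog_socket v hpv Dv Wm ψm hψm hΔ hA W e hμ hadd₁
    hadd₂ hgal hcompat hp5 E₀ hWE hΔ₀ hA₀ (N := N) hN hN1' halt hnondeg
  exact h1 hinj hde d w C hC hu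

end Summit.BirchSwinnertonDyer.BirchSwinnertonDyer.Theorems.TransportedReciprocitySocketLight

end
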